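import Mathlib
import Summits.Parity.BatemanHorn.Theorems.SoloBlindAlignment
import Summits.Parity.BatemanHorn.Theorems.SoloBlindSmoothPart
import Literature.NumberTheory.Sieve.IwaniecAlmostPrimesMertens

/-!
# Chebyshev–Markov for `k² + 1`: the aligned bilinear form has size `≥ (1/2 − o(1)) x`

Companion to `SoloBlindAlignment.lean`.  There the Type II bilinear form attached to
`J_x = {k² + 1 : k ≤ x}` with free coefficients was shown to equal its own trivial bound
`edgeCount x = #{k ≤ x : k² + 1 has a prime factor > 2x}` for root-aligned coefficients.  Here we
prove that this trivial bound is large — the classical valuation count of Chebyshev and Markov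
(1895; the starting point of Hooley, *Acta Math.* **117** (1967), and of every later result on the
greatest prime factor of `n² + 1`):

* `edgeCount_mul_log_ge` : `∃ C, ∀ x ≥ 2, x log x − C x ≤ edgeCount x · log (x² + 1)`;
* `eventually_edgeCount_ge` : `∀ ε > 0`, eventually `(1/2 − ε) x ≤ edgeCount x`.

Proof: `∑_{k ≤ x} log (k²+1) ≥ 2 log x! ≥ 2(x log x − x)` (Stirling, Mathlib); the primes `p ≤ 2x`
contribute at most `x R(2x) + 2θ(2x) + 4x + 2π(x) log(x²+1)` (`SoloBlindSmoothPart.smooth_part_le`),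
which is `x log x + O(x)` by Mertens' theorem for `ρ` (`Iwaniec1978.RhoMertensStrong_holds`, proved
in the tree from `L(1, χ₄) ≠ 0`) and Chebyshev's bounds `θ(y) ≤ y log 4`, `π(y) ≤ 2 log 4 · y/log y + √y`
(Mathlib); and each `k ≤ x` has at most one prime factor `> 2x`
(`SoloBlindAlignment.card_bigPrimes_le_one`), of logarithm `≤ log (x²+1)`.

Consequence (paper §10.1, Prop. 10.4 / Cor. 10.5): for the normalised indicator of `J_x` the
Ford–Maynard Type II hypothesis with free divisor-bounded coefficients fails by a constant factor
whenever the long variable contains the primes of `(2x, x² + 1]`.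
-/

open Finset Real

namespace Summit.Parity.BatemanHorn.Theorems.SoloBlindChebyshev

open Summit.Parity.BatemanHorn.Theorems.SoloBlindAlignment
open Summit.Parity.BatemanHorn.Theorems.SoloBlindSmoothPart
open Literature.NumberTheory.Sieve.Iwaniec1978

/-! ### The lower side and the main theorem -/

/-- `∑_{1 ≤ k ≤ x} log k = log x!`. -/
theorem sum_Icc_log_eq_log_factorial (x : ℕ) :
    ∑ k ∈ Icc 1 x, Real.log k = Real.log (x.factorial) := by
  induction x with
  | zero => simp
  | succ n ih =>
      rw [Finset.sum_Icc_succ_top (by omega), ih, Nat.factorial_succ, Nat.cast_mul,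
        Real.log_mul (by positivity) (by positivity)]
      push_cast
      ring

/-- `2 (x log x − x) ≤ ∑_{1 ≤ k ≤ x} log (k²+1)`. -/
theorem two_mul_sub_le_sum_log {x : ℕ} (hx : 1 ≤ x) :
    2 * ((x : ℝ) * Real.log x - x) ≤ ∑ k ∈ Icc 1 x, Real.log ((k : ℝ) ^ 2 + 1) := by
  have h1 : ∀ k ∈ Icc 1 x, 2 * Real.log k ≤ Real.log ((k : ℝ) ^ 2 + 1) := by
    intro k hk
    rw [Finset.mem_Icc] at hk
    have hk0 : (0 : ℝ) < k := by exact_mod_cast hk.1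
    rw [show (2 : ℝ) * Real.log k = Real.log ((k : ℝ) ^ 2) by rw [Real.log_pow]; norm_num]
    exact Real.log_le_log (by positivity) (by linarith)
  have h2 : ∑ k ∈ Icc 1 x, 2 * Real.log (k : ℝ) = 2 * Real.log (x.factorial) := by
    rw [← Finset.mul_sum, sum_Icc_log_eq_log_factorial]
  have h3 := Stirling.le_log_factorial_stirling (n := x) (by omega)
  have h4 : 0 ≤ Real.log x := Real.log_nonneg (by exact_mod_cast hx)
  have h5 : 0 ≤ Real.log (2 * Real.pi) := Real.log_nonneg (by linarith [Real.pi_gt_three])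
  calc 2 * ((x : ℝ) * Real.log x - x) ≤ 2 * Real.log (x.factorial) := by linarith
    _ = ∑ k ∈ Icc 1 x, 2 * Real.log (k : ℝ) := h2.symm
    _ ≤ ∑ k ∈ Icc 1 x, Real.log ((k : ℝ) ^ 2 + 1) := Finset.sum_le_sum h1

/-- The upper side: `∑_{1 ≤ k ≤ x} log (k²+1) ≤ edgeCount x · log (x²+1) + (smooth part)`. -/
theorem sum_log_le (x : ℕ) :
    ∑ k ∈ Icc 1 x, Real.log ((k : ℝ) ^ 2 + 1)
      ≤ (edgeCount x : ℝ) * Real.log ((x : ℝ) ^ 2 + 1)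
        + ∑ p ∈ Nat.primesLE (2 * x), Real.log p * ∑ k ∈ Icc 1 x, ((k ^ 2 + 1).factorization p : ℝ) := by
  have h1 : ∑ k ∈ Icc 1 x, Real.log ((k : ℝ) ^ 2 + 1)
      ≤ ∑ k ∈ Icc 1 x, (((bigPrimes x k).card : ℝ) * Real.log ((x : ℝ) ^ 2 + 1)
          + ∑ p ∈ Nat.primesLE (2 * x), ((k ^ 2 + 1).factorization p : ℝ) * Real.log p) := by
    apply Finset.sum_le_sum
    intro k hk
    rw [Finset.mem_Icc] at hk
    exact log_sq_add_one_le hk.2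
  have h2 : ∑ k ∈ Icc 1 x, ((bigPrimes x k).card : ℝ) ≤ (edgeCount x : ℝ) := by
    unfold edgeCount
    push_cast
    apply Finset.sum_le_sum_of_subset_of_nonneg
    · intro k hk
      rw [Finset.mem_Icc] at hk
      rw [Finset.mem_range]
      omega
    · intro _ _ _
      positivity
  have h3 : ∑ k ∈ Icc 1 x, ∑ p ∈ Nat.primesLE (2 * x), ((k ^ 2 + 1).factorization p : ℝ) * Real.log p
      = ∑ p ∈ Nat.primesLE (2 * x), Real.log p * ∑ k ∈ Icc 1 x, ((k ^ 2 + 1).factorization p : ℝ) := by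
    rw [Finset.sum_comm]
    apply Finset.sum_congr rfl
    intro p _
    rw [Finset.mul_sum]
    apply Finset.sum_congr rfl
    intro k _
    ring
  have hlog : 0 ≤ Real.log ((x : ℝ) ^ 2 + 1) := Real.log_nonneg (by nlinarith)
  rw [Finset.sum_add_distrib, ← Finset.sum_mul, h3] at h1
  nlinarith

/-- `π(x) log (x²+1) ≤ 12 log 4 · x + 6x`-type bound: the prime-power overhead is `O(x)`. -/
theorem card_primesLE_mul_log_le {x : ℕ} (hx : 2 ≤ x) :
    ((Nat.primesLE x).card : ℝ) * Real.log ((x : ℝ) ^ 2 + 1) ≤ (6 * Real.log 4 + 6) * x := by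
  have hx1 : (1 : ℝ) < x := by exact_mod_cast hx
  have hx0 : (0 : ℝ) < x := by linarith
  have hpi := Chebyshev.pi_le_log4_mul_div hx1
  rw [Nat.floor_natCast, ← Nat.primesLE_card_eq_primeCounting] at hpi
  have hsqrt : Real.log (Real.sqrt x) = Real.log x / 2 := Real.log_sqrt hx0.le
  rw [hsqrt] at hpi
  have hlogx : 0 < Real.log x := Real.log_pos hx1
  have hlog2 : Real.log 2 ≤ Real.log x := Real.log_le_log (by norm_num) (by exact_mod_cast hx)
  -- `log (x²+1) ≤ 3 log x`
  have hl3 : Real.log ((x : ℝ) ^ 2 + 1) ≤ 3 * Real.log x := by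
    have : (x : ℝ) ^ 2 + 1 ≤ 2 * (x : ℝ) ^ 2 := by nlinarith
    calc Real.log ((x : ℝ) ^ 2 + 1) ≤ Real.log (2 * (x : ℝ) ^ 2) :=
          Real.log_le_log (by positivity) this
      _ = Real.log 2 + 2 * Real.log x := by
          rw [Real.log_mul (by norm_num) (by positivity), Real.log_pow]; push_cast; ring
      _ ≤ 3 * Real.log x := by linarith
  -- `√x log x ≤ 2x`
  have hsl : Real.sqrt x * Real.log x ≤ 2 * x := by
    have hs0 : 0 < Real.sqrt x := Real.sqrt_pos.mpr hx0
    have h1 : Real.log (Real.sqrt x) ≤ Real.sqrt x - 1 := Real.log_le_sub_one_of_pos hs0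
    have h2 : Real.log x = 2 * Real.log (Real.sqrt x) := by rw [hsqrt]; ring
    have h3 : Real.sqrt x * Real.sqrt x = x := Real.mul_self_sqrt hx0.le
    nlinarith
  have hcard0 : (0 : ℝ) ≤ (Nat.primesLE x).card := by positivity
  have hl4 : 0 < Real.log 4 := Real.log_pos (by norm_num)
  -- `π(x) ≤ 2 log 4 · x / log x + √x`
  have hpi' : ((Nat.primesLE x).card : ℝ) * Real.log x ≤ 2 * Real.log 4 * x + Real.sqrt x * Real.log x := by
    have : ((Nat.primesLE x).card : ℝ) ≤ Real.log 4 * x / (Real.log x / 2) + Real.sqrt x := hpi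
    have hne : Real.log x ≠ 0 := ne_of_gt hlogx
    have e : Real.log 4 * x / (Real.log x / 2) * Real.log x = 2 * Real.log 4 * x := by
      field_simp
    have hmul := mul_le_mul_of_nonneg_right this hlogx.le
    rw [add_mul, e] at hmul
    linarith
  calc ((Nat.primesLE x).card : ℝ) * Real.log ((x : ℝ) ^ 2 + 1)
      ≤ ((Nat.primesLE x).card : ℝ) * (3 * Real.log x) := mul_le_mul_of_nonneg_left hl3 hcard0
    _ = 3 * (((Nat.primesLE x).card : ℝ) * Real.log x) := by ring
    _ ≤ 3 * (2 * Real.log 4 * x + 2 * x) := by linarith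
    _ = (6 * Real.log 4 + 6) * x := by ring

/-- **Chebyshev–Markov for `k² + 1`** (explicit form): there is `C` with
`x log x − C x ≤ edgeCount x · log (x² + 1)` for all `x ≥ 2`. -/
theorem edgeCount_mul_log_ge :
    ∃ C : ℝ, ∀ x : ℕ, 2 ≤ x →
      (x : ℝ) * Real.log x - C * x ≤ (edgeCount x : ℝ) * Real.log ((x : ℝ) ^ 2 + 1) := by
  obtain ⟨C₀, hC₀⟩ := RhoMertensStrong_holds
  refine ⟨6 + Real.log 2 + C₀ + 4 * Real.log 4 + 2 * (6 * Real.log 4 + 6), fun x hx => ?_⟩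
  have hx1 : 1 ≤ x := by omega
  have hxR : (1 : ℝ) ≤ x := by exact_mod_cast hx1
  have hlow := two_mul_sub_le_sum_log hx1
  have hup := sum_log_le x
  have hsm := smooth_part_le x
  have hpi := card_primesLE_mul_log_le hx
  -- Mertens for `ρ` at `t = 2x`
  have hM := hC₀ ((2 * x : ℕ) : ℝ) (by push_cast; linarith)
  have hM' : rhoLogSum ((2 * x : ℕ) : ℝ) ≤ Real.log ((2 * x : ℕ) : ℝ) + C₀ := by
    have := (abs_le.mp hM).2; linarith
  have hlog2x : Real.log ((2 * x : ℕ) : ℝ) = Real.log 2 + Real.log x := by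
    push_cast
    rw [Real.log_mul (by norm_num) (by positivity)]
  -- Chebyshev
  have hθ := Chebyshev.theta_le_log4_mul_x (x := ((2 * x : ℕ) : ℝ)) (by positivity)
  have hθ' : Chebyshev.theta ((2 * x : ℕ) : ℝ) ≤ Real.log 4 * (2 * (x : ℝ)) := by
    calc Chebyshev.theta ((2 * x : ℕ) : ℝ) ≤ Real.log 4 * ((2 * x : ℕ) : ℝ) := hθ
      _ = Real.log 4 * (2 * (x : ℝ)) := by push_cast; ring
  have hx0 : (0 : ℝ) ≤ x := by positivity
  have hM2 : (x : ℝ) * rhoLogSum ((2 * x : ℕ) : ℝ) ≤ x * (Real.log 2 + Real.log x + C₀) := by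
    rw [← hlog2x]
    exact mul_le_mul_of_nonneg_left hM' hx0
  linarith

/-- **Chebyshev–Markov for `k² + 1`** (proportion form): for every `ε > 0`, eventually
`(1/2 − ε) x ≤ edgeCount x = #{k ≤ x : k² + 1 has a prime factor > 2x}`. -/
theorem eventually_edgeCount_ge {ε : ℝ} (hε : 0 < ε) :
    ∀ᶠ x : ℕ in Filter.atTop, (1 / 2 - ε) * (x : ℝ) ≤ (edgeCount x : ℝ) := by
  obtain ⟨C, hC⟩ := edgeCount_mul_log_ge
  rw [Filter.eventually_atTop]
  refine ⟨max 2 (⌈Real.exp ((|C| + Real.log 2) / (2 * ε))⌉₊ + 1), fun x hx => ?_⟩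
  have hx2 : 2 ≤ x := le_trans (le_max_left _ _) hx
  have hxe : Real.exp ((|C| + Real.log 2) / (2 * ε)) < x := by
    have h1 : (⌈Real.exp ((|C| + Real.log 2) / (2 * ε))⌉₊ : ℝ) + 1 ≤ x := by
      exact_mod_cast le_trans (le_max_right _ _) hx
    have h2 := Nat.le_ceil (Real.exp ((|C| + Real.log 2) / (2 * ε)))
    linarith
  have hx0 : (0 : ℝ) < x := by exact_mod_cast (by omega : 0 < x)
  have hlogx : (|C| + Real.log 2) / (2 * ε) < Real.log x := by
    rw [Real.lt_log_iff_exp_lt hx0]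
    exact hxe
  have hlogx' : |C| + Real.log 2 < 2 * ε * Real.log x := by
    have := (div_lt_iff₀ (show (0 : ℝ) < 2 * ε by positivity)).mp hlogx
    linarith
  have hmain := hC x hx2
  have hE0 : (0 : ℝ) ≤ edgeCount x := by positivity
  by_cases hε2 : 1 / 2 - ε ≤ 0
  · have : (1 / 2 - ε) * (x : ℝ) ≤ 0 := mul_nonpos_of_nonpos_of_nonneg hε2 hx0.le
    linarith
  have hε2 : 0 < 1 / 2 - ε := not_le.mp hε2
  -- `log (x²+1) ≤ 2 log x + log 2`
  have hl : Real.log ((x : ℝ) ^ 2 + 1) ≤ 2 * Real.log x + Real.log 2 := by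
    have : (x : ℝ) ^ 2 + 1 ≤ 2 * (x : ℝ) ^ 2 := by
      have : (1 : ℝ) ≤ x := by exact_mod_cast (by omega : 1 ≤ x)
      nlinarith
    calc Real.log ((x : ℝ) ^ 2 + 1) ≤ Real.log (2 * (x : ℝ) ^ 2) :=
          Real.log_le_log (by positivity) this
      _ = 2 * Real.log x + Real.log 2 := by
          rw [Real.log_mul (by norm_num) (by positivity), Real.log_pow]; push_cast; ring
  have hlpos : 0 < Real.log ((x : ℝ) ^ 2 + 1) := Real.log_pos (by nlinarith)
  by_contra hcon
  have hcon := not_le.mp hcon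
  -- then `E log(x²+1) < (1/2 − ε) x (2 log x + log 2)`
  have h1 : (edgeCount x : ℝ) * Real.log ((x : ℝ) ^ 2 + 1)
      < (1 / 2 - ε) * x * (2 * Real.log x + Real.log 2) := by
    calc (edgeCount x : ℝ) * Real.log ((x : ℝ) ^ 2 + 1)
        < (1 / 2 - ε) * x * Real.log ((x : ℝ) ^ 2 + 1) := by
          exact mul_lt_mul_of_pos_right hcon hlpos
      _ ≤ (1 / 2 - ε) * x * (2 * Real.log x + Real.log 2) := by
          exact mul_le_mul_of_nonneg_left hl (by positivity)
  have hC' : C ≤ |C| := le_abs_self C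
  have hlog2 : 0 < Real.log 2 := Real.log_pos (by norm_num)
  have hprod := mul_lt_mul_of_pos_left hlogx' hx0
  have hCx : C * x ≤ |C| * x := mul_le_mul_of_nonneg_right hC' hx0.le
  have hεx : 0 ≤ ε * x * Real.log 2 := by positivity
  nlinarith [hprod, hCx, hεx, h1, hmain]

end Summit.Parity.BatemanHorn.Theorems.SoloBlindChebyshev
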